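import Summits.CriticalPhenomena.PercolationContinuityZ3.Theorems.Transplant.PlanarSkeletonFrmFromDefs
import Summits.CriticalPhenomena.PercolationContinuityZ3.Theorems.Transplant.SkelFrmFromBChoiceDefsT
import Summits.CriticalPhenomena.PercolationContinuityZ3.Theorems.Transplant.SkelFrmBChoiceDefsT
import Summits.CriticalPhenomena.PercolationContinuityZ3.Theorems.Transplant.SkelFrmFromBParamsFineSize
import Summits.CriticalPhenomena.PercolationContinuityZ3.Theorems.Transplant.SkelFrmBParamsFineSize
import Summits.CriticalPhenomena.PercolationContinuityZ3.Theorems.Transplant.SkelNegBParamsSchedA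
import Summits.CriticalPhenomena.PercolationContinuityZ3.Theorems.Transplant.SkelFrmFromBParamsSchedA
import Summits.CriticalPhenomena.PercolationContinuityZ3.Theorems.Transplant.SkelFrmBParamsSchedA
import HarnessLib
import Summits.CriticalPhenomena.PercolationContinuityZ3.Theorems.Transplant.SkelFrmBParamsSchedAT
/-!
# U-WAVE PORT (RULING D-U, lead g21 2026-08-26; WAVE-U-MANIFEST v3.1 row «SkelFrmBParamsSchedAT» ↦ «SkelFrmFromBParamsSchedAT») of the tree module
# `Transplant/SkelFrmBParamsSchedAT` onto the carrier `PlanarSkeletonFrmFrom` (frames only, cylinders connected from width `ℓ₀` on)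

ORIGINAL TITLE: (R-40) `…T` TWIN (stmt-g21, 2026-08-23; ruling p3-g16 06:23:56Z, J18; lead g11 06:35:07Z: the choice function of record moves to `frmChoiceAllQ3T`): the twin of

builds on p205010 (kernel theorem, internal audit signed; external expert review pending) — nothing in this file uses p205010; NOTHING is claimed about the
OPEN node U `SamePDropOfSkeletonFrmFrom₁` (nor U_s / the end state).  Lane `prim-bschramm`, seat `prim-bschramm-stmt` gen 26 (port pen, RULING M-11 family P-stmt; tool = p3-g26's port_u.py of record, registry-driven inputs); helper file
(`--supports stmt-CriticalPhenomena-4575 --as helper`).  PORT RULES r1–r4 of RULING D-U: declaration order and proof texts are those of the original,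
byte-identical except (i) the carrier token `PlanarSkeletonFrm ↦ PlanarSkeletonFrmFrom` (binders, `namespace`/`end` lines, qualified names of twinned
declarations), (ii) carrier-FREE declarations of the original (φ-level `Skelφ…` blocks and namespace-only arithmetic residents) are NOT re-declared —
this file imports the original and `export`s the twin-free residents (POLICY T / treatment (m1)); residents whose statement mentions a twinned
constant are copied, (iii) every carrier-binding declaration keeps its explicit binder `(Φ : PlanarSkeletonFrmFrom G)` in its own signature (r2).  Docstrings and citations are the original's.
-/

noncomputable section

open scoped Classical

namespace Summit.CriticalPhenomena.PercolationContinuityZ3.Theorems.Transplant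

open Literature.Probability.Percolation Literature.Probability.LatticeModels SimpleGraph KNCells

namespace PlanarSkeletonFrmFrom

namespace NegB

open SkelConc (Consts)
open BoxProdZ2 (ConcRadiiG)
open Literature.Probability.Percolation.KozmaNitzan.Cells (oth)
open Neg

section Sched

variable (κ : Consts) {V : Type} [DecidableEq V] [Countable V] {G : SimpleGraph V} [G.LocallyFinite] (Φ : PlanarSkeletonFrmFrom G) (t : V)
  (p : unitInterval) (D : Skelφ.StepI.DataNS V) (g f : ℕ) (c : Fin 2 → ℕ)

/-! ## §1 The lattice record of the (ζ′)/(ζ″) cells -/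

-- (cell-free, not re-declared: `prFA` of SkelFrmBParamsSchedA)

-- (cell-free, not re-declared: `prFA_fields` of SkelFrmBParamsSchedA)

-- (cell-free, not re-declared: `prFA_ψ` of SkelFrmBParamsSchedA)

-- (cell-free, not re-declared: `prFA_D` of SkelFrmBParamsSchedA)

-- (cell-free, not re-declared: `prFA_c_pos` of SkelFrmBParamsSchedA)

-- (cell-free, not re-declared: `prFA_c_eq` of SkelFrmBParamsSchedA)

-- (cell-free, not re-declared: `prFA_c_eq_twenty_r` of SkelFrmBParamsSchedA)

-- (cell-free, not re-declared: `prFA_room` of SkelFrmBParamsSchedA)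

/-! ## §2 The linear column bound at the staggered centre -/

-- (cell-free, not re-declared: `abs_rep₂_le_of_abs_le` of SkelFrmBParamsSchedA)

/-- **The staggered centre grows linearly**: `|cenS x|ⱼ ≤ 20·r_j·(|x₀| + |x₁|)` (the creep FELT on coordinate `j` is `c (oth j) ≤ r_j`, the per-axis cap). [folklore] -/
theorem abs_cenS_leT (κ : Consts) {V : Type} [DecidableEq V] [Countable V] {G : SimpleGraph V} [G.LocallyFinite] (Φ : PlanarSkeletonFrmFrom G) (t : V) (p : unitInterval) (D : Skelφ.StepI.DataNS V) (g : ℕ) (f : ℕ) (c : Fin 2 → ℕ) (x : Site 2) (j : Fin 2) :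
    |(fcellsT κ Φ t p D g f c).cenS x j| ≤ 20 * (((fcellsA κ Φ t p D g f).r j : ℕ) : ℤ) * (|x 0| + |x 1|) := by
  set P := fcellsT κ Φ t p D g f c
  have key : ∀ a b ca r : ℤ, 0 ≤ r → 0 ≤ ca → ca ≤ r → |20 * r * a + ca * b| ≤ 20 * r * (|a| + |b|) := by
    intro a b ca r hr hca hcr
    have h1 : |20 * r * a + ca * b| ≤ 20 * r * |a| + ca * |b| := by
      calc |20 * r * a + ca * b| ≤ |20 * r * a| + |ca * b| := abs_add_le _ _
        _ = 20 * r * |a| + ca * |b| := by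
            rw [abs_mul, abs_mul, abs_mul, abs_of_nonneg hr, abs_of_nonneg hca, abs_of_nonneg (by norm_num : (0 : ℤ) ≤ 20)]
    nlinarith [abs_nonneg a, abs_nonneg b, mul_le_mul_of_nonneg_right hcr (abs_nonneg b)]
  have hr : ∀ k, (0 : ℤ) ≤ (((fcellsA κ Φ t p D g f).r k : ℕ) : ℤ) := fun k => by positivity
  have hc10 : P.c 1 ≤ (((fcellsA κ Φ t p D g f).r 0 : ℕ) : ℤ) := by
    have h := P.hcr 1; have e : oth (1 : Fin 2) = 0 := by decide
    rw [e] at h; exact h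
  have hc01 : P.c 0 ≤ (((fcellsA κ Φ t p D g f).r 1 : ℕ) : ℤ) := by
    have h := P.hcr 0; have e : oth (0 : Fin 2) = 1 := by decide
    rw [e] at h; exact h
  rw [PCells2T.cenS_apply]
  fin_cases j
  · show |20 * (((fcellsA κ Φ t p D g f).r 0 : ℕ) : ℤ) * x 0 + P.c 1 * x 1| ≤ 20 * (((fcellsA κ Φ t p D g f).r 0 : ℕ) : ℤ) * (|x 0| + |x 1|)
    exact key (x 0) (x 1) (P.c 1) _ (hr 0) (P.hc0 1) hc10
  · show |20 * (((fcellsA κ Φ t p D g f).r 1 : ℕ) : ℤ) * x 1 + P.c 0 * x 0| ≤ 20 * (((fcellsA κ Φ t p D g f).r 1 : ℕ) : ℤ) * (|x 0| + |x 1|)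
    rw [add_comm (|x 0|)]
    exact key (x 1) (x 0) (P.c 0) _ (hr 1) (P.hc0 0) hc01

/-- **`NrepA (cenS x) ≤ A·(L̂₁ + L̂₀)·(|x₀| + |x₁|)`** (rounding bound + the linear growth of the staggered centre). [this work] -/
theorem NrepA_cenS_leT (κ : Consts) {V : Type} [DecidableEq V] [Countable V] {G : SimpleGraph V} [G.LocallyFinite] (Φ : PlanarSkeletonFrmFrom G) (t : V) (p : unitInterval) (D : Skelφ.StepI.DataNS V) (g : ℕ) (f : ℕ) (c : Fin 2 → ℕ) (x : Site 2) :
    (NrepA κ Φ t p D g f ((fcellsT κ Φ t p D g f c).cenS x) : ℤ) ≤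
      Aof κ * (Skelφ.NegPrm.L1hat (nL κ Φ t p D g f) (hL κ Φ t p D g f) +
        Skelφ.NegPrm.L0hat (nL κ Φ t p D g f) (hL κ Φ t p D g f) (ℓL κ Φ t p D g f) (vL κ Φ t p D g f)) * (|x 0| + |x 1|) := by
  have hA : 0 < Aof κ := (Aof_pos κ).1
  have hz0 := abs_cenS_leT κ Φ t p D g f c x 0
  have hz1 := abs_cenS_leT κ Φ t p D g f c x 1
  have e0 : 20 * (((fcellsA κ Φ t p D g f).r 0 : ℕ) : ℤ) = 20 * ((fcellsA κ Φ t p D g f).K : ℤ) * (((fcellsA κ Φ t p D g f).s 0 : ℕ) : ℤ) := by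
    simp [PCells2.r]; ring
  have e1 : 20 * (((fcellsA κ Φ t p D g f).r 1 : ℕ) : ℤ) = 20 * ((fcellsA κ Φ t p D g f).K : ℤ) * (((fcellsA κ Φ t p D g f).s 1 : ℕ) : ℤ) := by
    simp [PCells2.r]; ring
  rw [e0] at hz0; rw [e1] at hz1
  obtain ⟨b0, b1⟩ := abs_rep₂_le_of_abs_le (A := Aof κ) (n := (nL κ Φ t p D g f : ℤ)) (h := hL κ Φ t p D g f) (vα := vL κ Φ t p D g f)
    (vβ := vβL κ Φ t p D g f) (cA_pos κ Φ t p D g f 0) (cA_pos κ Φ t p D g f 1) hz0 hz1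
  unfold NrepA
  push_cast
  rw [abs_of_pos hA] at b0 b1
  unfold Skelφ.NegPrm.L1hat Skelφ.NegPrm.L0hat
  unfold vβL at b0 b1 ⊢
  have hn : |(nL κ Φ t p D g f : ℤ)| = nL κ Φ t p D g f := abs_of_nonneg (by positivity)
  rw [hn] at b0
  have e : Aof κ * (((nL κ Φ t p D g f : ℤ) + |vL κ Φ t p D g f|)) * (|x 0| + |x 1|) +
      Aof κ * ((|hL κ Φ t p D g f| + |Skelφ.NegPrm.vβOf (nL κ Φ t p D g f) (hL κ Φ t p D g f) (ℓL κ Φ t p D g f) (vL κ Φ t p D g f)|)) * (|x 0| + |x 1|) =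
      Aof κ * (((nL κ Φ t p D g f : ℤ) + |hL κ Φ t p D g f|) +
        (|Skelφ.NegPrm.vβOf (nL κ Φ t p D g f) (hL κ Φ t p D g f) (ℓL κ Φ t p D g f) (vL κ Φ t p D g f)| + |vL κ Φ t p D g f|)) * (|x 0| + |x 1|) := by ring
  linarith

-- (cell-free, not re-declared: `cOffS` of SkelFrmBParamsSchedA)

-- (cell-free, not re-declared: `cOffS_int` of SkelFrmBParamsSchedA)

/-- **THE LINEAR COLUMN BOUND AT THE STAGGERED CENTRE (the (F) binder `hoff`)**: `offNT x ≤ cOffS·(|x₀| + |x₁|) + 1`, under the numeric long clause and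
`|h_L| ≤ 10·n_L`, for EVERY creep value. [this work] -/
theorem offNT_le (κ : Consts) {V : Type} [DecidableEq V] [Countable V] {G : SimpleGraph V} [G.LocallyFinite] (Φ : PlanarSkeletonFrmFrom G) (t : V) (p : unitInterval) (D : Skelφ.StepI.DataNS V) (g : ℕ) (f : ℕ) (c : Fin 2 → ℕ) (hN : EqNumL κ Φ t p D g f) (hκ : (hL κ Φ t p D g f).natAbs ≤ 10 * nL κ Φ t p D g f) (x : Site 2) :
    offNT κ Φ t p D g f c x ≤ cOffS κ Φ t p D g f * ((x 0).natAbs + (x 1).natAbs) + 1 := by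
  have h := NrepA_cenS_leT κ Φ t p D g f c x
  have hL0 := L0hat_le κ Φ t p D g f hN hκ
  have hL1 := L1hat_le κ Φ t p D g f hκ
  have hA : 0 < Aof κ := (Aof_pos κ).1
  have hℓ0 : (0 : ℤ) ≤ ℓL κ Φ t p D g f := by positivity
  have hn0 : (0 : ℤ) ≤ nL κ Φ t p D g f := by positivity
  have hx : (0 : ℤ) ≤ |x 0| + |x 1| := by positivity
  have hsum : Skelφ.NegPrm.L1hat (nL κ Φ t p D g f) (hL κ Φ t p D g f) +
      Skelφ.NegPrm.L0hat (nL κ Φ t p D g f) (hL κ Φ t p D g f) (ℓL κ Φ t p D g f) (vL κ Φ t p D g f) ≤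
      2 * ((ℓL κ Φ t p D g f : ℤ) + 21 * nL κ Φ t p D g f + 1) := by linarith
  have key : (NrepA κ Φ t p D g f ((fcellsT κ Φ t p D g f c).cenS x) : ℤ) ≤ 2 * (Aof κ * ((ℓL κ Φ t p D g f : ℤ) + 21 * nL κ Φ t p D g f + 1)) * (|x 0| + |x 1|) := by
    have s := mul_le_mul_of_nonneg_right (mul_le_mul_of_nonneg_left hsum hA.le) hx
    have e : Aof κ * (2 * ((ℓL κ Φ t p D g f : ℤ) + 21 * nL κ Φ t p D g f + 1)) * (|x 0| + |x 1|) =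
        2 * (Aof κ * ((ℓL κ Φ t p D g f : ℤ) + 21 * nL κ Φ t p D g f + 1)) * (|x 0| + |x 1|) := by ring
    linarith
  unfold offNT
  have : (NrepA κ Φ t p D g f ((fcellsT κ Φ t p D g f c).cenS x) : ℤ) ≤ ((cOffS κ Φ t p D g f * ((x 0).natAbs + (x 1).natAbs) : ℕ) : ℤ) := by
    push_cast; rw [cOffS_int]; exact key
  have := Int.ofNat_le.1 this
  omega

/-- **The (F) binder `hoffN` at the staggered centre**: `‖rep₂ prFA… (cenS x)‖₁ + 1 ≤ offNT x` (by definition of `offNT`). [folklore] -/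
theorem hoffNT_at (κ : Consts) {V : Type} [DecidableEq V] [Countable V] {G : SimpleGraph V} [G.LocallyFinite] (Φ : PlanarSkeletonFrmFrom G) (t : V) (p : unitInterval) (D : Skelφ.StepI.DataNS V) (g : ℕ) (f : ℕ) (c : Fin 2 → ℕ) (x : Site 2) :
    (TwoAxis.Para.rep₂ (prFA κ Φ t p D g f).A (prFA κ Φ t p D g f).n (prFA κ Φ t p D g f).h (prFA κ Φ t p D g f).vα (prFA κ Φ t p D g f).vβ (prFA κ Φ t p D g f).c₀
          (prFA κ Φ t p D g f).c₁ ((fcellsT κ Φ t p D g f c).cenS x) 0).natAbs +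
        (TwoAxis.Para.rep₂ (prFA κ Φ t p D g f).A (prFA κ Φ t p D g f).n (prFA κ Φ t p D g f).h (prFA κ Φ t p D g f).vα (prFA κ Φ t p D g f).vβ (prFA κ Φ t p D g f).c₀
          (prFA κ Φ t p D g f).c₁ ((fcellsT κ Φ t p D g f c).cenS x) 1).natAbs + 1 ≤ offNT κ Φ t p D g f c x :=
  le_rfl

end Sched

end NegB

end PlanarSkeletonFrmFrom

end Summit.CriticalPhenomena.PercolationContinuityZ3.Theorems.Transplant

end
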